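import Literature.Analysis.FunctionSpaces.TorusSpaceTime
import Literature.Analysis.FunctionSpaces.TorusCalculusProofs
import Literature.Analysis.FunctionSpaces.TorusConvolution
import HarnessLib

/-!
# The smooth Leray–Helmholtz decomposition on the flat torus (named fact) and its proved API

Analysis/FunctionSpaces support file. On the flat torus `T^d` every square-integrable vector
field splits `L²`-orthogonally into a (weakly) divergence-free field and a gradient
(Helmholtz–Weyl; Robinson–Rodrigo–Sadowski 2016, Thm. 2.6, Def. 2.8: `u = h + ∇g`, `h = ℙu`,
computed frequency-wise by `û_k = (û_k - (û_k·k/|k|²) k) + (û_k·k/|k|²) k`), the split preserves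
Sobolev regularity of every order (Thm. 2.6 (ii): `u ∈ Ḣ^s ⇒ h ∈ Ḣ^s, g ∈ Ḣ^{s+1}`) and the
Leray projector `ℙ` commutes with derivatives (Lemma 2.9). Two NAMED FACTS (`def … : Prop`, D-0014)
are vendored here, to be discharged from the Fourier calculus of `TorusFourierSeries` /
`TorusFourierCalculus`:

* `Torus.smooth_helmholtz` — the **fixed-time smooth form**: every `G₀ ∈ C^∞(T^d; ℝ^d)` is
  `w₀ + ∇φ₀` with `w₀` smooth divergence free and `φ₀` smooth of zero mean. This is the corollary
  of Thm. 2.6 (ii) for all `s` together with the Sobolev embedding `⋂ₛ H^s = C^∞` (the constant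
  `⨍ G₀` being put into `w₀`); printed on `T³`, the frequency-wise proof is verbatim on `T^d`.
  Tagged with the RRS cite.
* `Torus.smooth_leray_helmholtz` — the **space–time form**: for `G ∈ C^∞(ℝ × T^d; ℝ^d)` the
  decomposition `G(t) = w(t) + ∇φ(t)` can be chosen jointly smooth in `(t, x)`. This
  parametric clause is not printed at the RRS locators; it follows because `ℙ` is a Fourier
  multiplier of order `0` (bounded on every `H^s`, commuting with `∂ₜ` by linearity and with `∂ⱼ`
  by Lemma 2.9), so `t ↦ ℙ G(t)` is `C^∞` into every `H^s`. It is therefore tagged `[folklore]`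
  with the derivation in its docstring, and it implies the fixed-time form
  (`smooth_leray_helmholtz.smooth_helmholtz`). Classical (`C^∞`) Navier–Stokes constructions
  consume this form (pressure recovery for `2½`-dimensional flows, Bruè–De Lellis 2023 §3;
  Cheskidov 2023 §6).

Nearest existing tree object: `Literature/Analysis/FluidPDE/LerayProjector.lean` has the `L²`
Leray projector `Torus.lerayProjector d` (orthogonal projection of `L²` classes onto the
mean-zero energy space, with the multiplier formula as an unproved fact). That is the right object
for weak solutions but does not give pointwise smooth representatives, let alone joint smoothness
in a time parameter, which is what a classical force/pressure needs; hence this file (it also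
supersedes the bounced pre-rename proposal `TorusHodgeDecomposition.lean`, p14812, same purpose).

Everything a user needs *about* such a decomposition is PROVED here from the torus calculus
(integration by parts on `T^d`, `TorusCalculusProofs`):

* `∫_{T^d} ∇φ = 0` (`Torus.integral_gradient_eq_zero` of `TorusConvolution`), hence the solenoidal
  part carries the mean (`Torus.integral_add_gradient`, `Torus.hasZeroMean_add_gradient_iff`);
* `Torus.integral_norm_sq_add_gradient` — Pythagoras `∫‖w + ∇φ‖² = ∫‖w‖² + ∫‖∇φ‖²` for smooth
  divergence-free `w` (RRS 2016, Cor. 2.5 / (2.3)), whence the `L²`-contractivity of the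
  solenoidal part `Torus.eLpNorm_le_eLpNorm_add_gradient` (RRS 2016, Thm. 2.6 proof:
  `‖h‖² + ‖∇g‖² = ‖u‖²`);
* `Torus.gradient_eq_zero_of_isDivFree` — a divergence-free gradient vanishes;
  `Torus.helmholtz_unique` — uniqueness of the solenoidal part (RRS 2016, Thm. 2.6, uniqueness);
* `Torus.periodic_of_helmholtz` — the solenoidal part of a time-periodic field is time-periodic.

## References

* J. C. Robinson, J. L. Rodrigo, W. Sadowski, *The Three-Dimensional Navier–Stokes Equations:
  Classical Theory* (CUP 2016), §2.1: Def. 2.1, Cor. 2.5, Thm. 2.6 (with (ii)), Def. 2.8,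
  Lemma 2.9 (book pp. 42–45). [RobinsonRodrigoSadowskiCUP2016]
* E. Bruè, C. De Lellis, Comm. Math. Phys. 400 (2023), §3; A. Cheskidov, arXiv:2311.04182, §6
  (consumers: pressure of `2½`-dimensional Navier–Stokes solutions).
-/

open Set Filter Topology Function MeasureTheory
open scoped ENNReal InnerProductSpace ContDiff

noncomputable section

namespace Literature.Analysis.FunctionSpaces.Torus

variable {d : Type*} [Fintype d] [DecidableEq d]

/-! ## The named facts -/

variable (d) in
/-- **Smooth Helmholtz–Weyl decomposition on `T^d`, fixed time** (Robinson–Rodrigo–Sadowski 2016,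
Thm. 2.6 with (ii)): every smooth vector field `G₀ ∈ C^∞(T^d; ℝ^d)` can be written as
`G₀ = w₀ + ∇φ₀` with `w₀ ∈ C^∞` divergence free and `φ₀ ∈ C^∞` of zero mean. *Relation to the
printed statement:* Thm. 2.6 decomposes `u ∈ L̇²(T³)` uniquely as `h + ∇g`, `h ∈ H` (Fourier
coefficients orthogonal to `k`, Def. 2.1, hence divergence free), `g ∈ Ḣ¹` of zero mean, and (ii)
gives `h ∈ Ḣ^s`, `g ∈ Ḣ^{s+1}` whenever `u ∈ Ḣ^s`; for smooth `G₀` apply this to `G₀ - ⨍G₀` for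
every `s > 0` and use the Sobolev embedding `⋂ₛ H^s(T^d) = C^∞(T^d)`, then put the constant
`⨍ G₀` (divergence free) into `w₀ := h + ⨍ G₀`. Printed on `T³`; the frequency-wise proof is
verbatim on `T^d` for a finite index type `d` (used with `d = Fin 2, Fin 3`). Orthogonality,
uniqueness and `L²`-contractivity are *proved* below, not assumed. [cite: RobinsonRodrigoSadowskiCUP2016, Thm. 2.6 (ii) (pp. 43–44)] -/
def smooth_helmholtz : Prop :=
  ∀ (G₀ : UnitAddTorus d → EuclideanSpace ℝ d), IsSmooth G₀ →
    ∃ (w₀ : UnitAddTorus d → EuclideanSpace ℝ d) (φ₀ : UnitAddTorus d → ℝ),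
      IsSmooth w₀ ∧ IsSmooth φ₀ ∧ IsDivFree w₀ ∧ HasZeroMean φ₀ ∧
        ∀ x, G₀ x = w₀ x + Torus.gradient φ₀ x

variable (d) in
/-- **Smooth Leray–Helmholtz decomposition on `T^d`, space–time form.** For every vector field
`G ∈ C^∞(ℝ × T^d; ℝ^d)` (jointly smooth, `Torus.IsSmoothSpaceTimeOn univ`) there are
`w ∈ C^∞(ℝ × T^d; ℝ^d)` and `φ ∈ C^∞(ℝ × T^d)` with, at every time `t`, `div w(t) = 0`,
`∫ φ(t) = 0` and `G(t, x) = w(t, x) + ∇φ(t)(x)` (`w(t) = ℙG(t) + ⨍G(t)`). *Derivation (standard,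
not printed as such):* at each fixed time this is `smooth_helmholtz` (Robinson–Rodrigo–Sadowski
2016, Thm. 2.6 (ii)); the Leray projector `ℙ` (Def. 2.8) is the Fourier multiplier
`û_k ↦ û_k - (û_k·k/|k|²)k`, bounded on every `H^s` and commuting with derivatives (Lemma 2.9 for
`∂ⱼ`; with `∂ₜ` by linearity and continuity), so for `G ∈ C^∞(ℝ; H^s)` (all `s`) also
`ℙG, G - ℙG ∈ C^∞(ℝ; H^s)` for all `s`, i.e. `w` and the mean-zero potential `φ` of the gradient
part are jointly smooth. Implies the fixed-time form (`smooth_leray_helmholtz.smooth_helmholtz`). [folklore] -/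
def smooth_leray_helmholtz : Prop :=
  ∀ (G : ℝ → UnitAddTorus d → EuclideanSpace ℝ d), IsSmoothSpaceTimeOn univ G →
    ∃ (w : ℝ → UnitAddTorus d → EuclideanSpace ℝ d) (φ : ℝ → UnitAddTorus d → ℝ),
      IsSmoothSpaceTimeOn univ w ∧ IsSmoothSpaceTimeOn univ φ ∧
      (∀ t, IsDivFree (w t)) ∧ (∀ t, HasZeroMean (φ t)) ∧
      ∀ t x, G t x = w t x + Torus.gradient (φ t) x

/-- The space–time form implies the fixed-time form (apply it to the time-independent field
`t ↦ G₀` and take the slice `t = 0`). [folklore] -/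
theorem smooth_leray_helmholtz.smooth_helmholtz (h : smooth_leray_helmholtz d) : smooth_helmholtz d := by
  intro G₀ hG₀
  obtain ⟨w, φ, hw, hφ, hdiv, hmean, hdec⟩ := h (fun _ => G₀) (isSmoothSpaceTimeOn_const hG₀ univ)
  exact ⟨w 0, φ 0, hw.isSmooth_slice (mem_univ 0), hφ.isSmooth_slice (mem_univ 0), hdiv 0, hmean 0,
    hdec 0⟩

/-! ## Linearity of the torus operators on differences (`C¹` data) -/

omit [DecidableEq d] in
/-- `D(f - g) = Df - Dg` for `C¹` functions on the torus (Mathlib `fderiv_sub` on the re-centred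
lifts). [folklore] -/
theorem fderiv_sub {F : Type*} [NormedAddCommGroup F] [NormedSpace ℝ F] {f g : UnitAddTorus d → F}
    (hf : IsContDiff 1 f) (hg : IsContDiff 1 g) (x : UnitAddTorus d) :
    Torus.fderiv (f - g) x = Torus.fderiv f x - Torus.fderiv g x := by
  unfold Torus.fderiv
  rw [show liftAt (f - g) x = liftAt f x - liftAt g x from rfl]
  exact _root_.fderiv_sub ((hf.liftAt x).differentiable one_ne_zero).differentiableAt
    ((hg.liftAt x).differentiable one_ne_zero).differentiableAt

omit [DecidableEq d] in
/-- `∇(φ - ψ) = ∇φ - ∇ψ` for `C¹` scalars on the torus. [folklore] -/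
theorem gradient_sub {φ ψ : UnitAddTorus d → ℝ} (hφ : IsContDiff 1 φ) (hψ : IsContDiff 1 ψ)
    (x : UnitAddTorus d) :
    Torus.gradient (φ - ψ) x = Torus.gradient φ x - Torus.gradient ψ x := by
  refine ext_inner_right ℝ fun w => ?_
  rw [inner_gradient_left, fderiv_sub hφ hψ, FunLike.coe_sub, Pi.sub_apply, inner_sub_left,
    inner_gradient_left, inner_gradient_left]

/-- `div (u - v) = div u - div v` for `C¹` vector fields on the torus. [folklore] -/
theorem divergence_sub {u v : UnitAddTorus d → EuclideanSpace ℝ d} (hu : IsContDiff 1 u)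
    (hv : IsContDiff 1 v) (x : UnitAddTorus d) :
    divergence (u - v) x = divergence u x - divergence v x := by
  rw [divergence_eq_trace_fderiv (u := u - v) (hu.sub hv), divergence_eq_trace_fderiv hu,
    divergence_eq_trace_fderiv hv, fderiv_sub hu hv, ContinuousLinearMap.toLinearMap_sub, map_sub]

/-- Differences of `C¹` divergence-free fields are divergence free (private local twin of the
dot-notation lemma `Torus.IsDivFree.sub` proved in
`Barriers/AnomalousDissipation/ClassicalEulerLimitProofs`, which a function-space file must not
import). [folklore] -/
private theorem isDivFree_sub {u v : UnitAddTorus d → EuclideanSpace ℝ d} (hu : IsContDiff 1 u)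
    (hv : IsContDiff 1 v) (hdu : IsDivFree u) (hdv : IsDivFree v) : IsDivFree (u - v) := fun x => by
  rw [divergence_sub hu hv, hdu x, hdv x, sub_zero]

/-! ## Gradients have zero mean; the solenoidal part carries the mean -/

omit [DecidableEq d] in
/-- The mean of `w + ∇φ` is the mean of `w` (smooth data). [folklore] -/
theorem integral_add_gradient {w : UnitAddTorus d → EuclideanSpace ℝ d} {φ : UnitAddTorus d → ℝ}
    (hw : IsSmooth w) (hφ : IsSmooth φ) :
    ∫ x, (w x + Torus.gradient φ x) = ∫ x, w x := by
  rw [integral_add hw.integrable hφ.gradient.integrable, integral_gradient_eq_zero hφ, add_zero]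

omit [DecidableEq d] in
/-- `w + ∇φ` has zero mean iff `w` has (smooth data): in a Helmholtz decomposition of a mean-zero
field the solenoidal part is mean zero. [folklore] -/
theorem hasZeroMean_add_gradient_iff {w : UnitAddTorus d → EuclideanSpace ℝ d}
    {φ : UnitAddTorus d → ℝ} (hw : IsSmooth w) (hφ : IsSmooth φ) :
    HasZeroMean (fun x => w x + Torus.gradient φ x) ↔ HasZeroMean w := by
  unfold HasZeroMean
  rw [integral_add_gradient hw hφ]

/-! ## Orthogonality, contractivity, uniqueness -/

/-- **Pythagoras for the Helmholtz split** (Robinson–Rodrigo–Sadowski 2016, Cor. 2.5 and (2.3):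
`‖h‖² + ‖∇g‖² = ‖u‖²`): for smooth divergence-free `w` and smooth `φ`,
`∫‖w + ∇φ‖² = ∫‖w‖² + ∫‖∇φ‖²` (the cross term `2∫⟪w, ∇φ⟫` vanishes by integration by parts). [cite: RobinsonRodrigoSadowskiCUP2016, Cor. 2.5 and Thm. 2.6 proof (2.3) (pp. 43–44)] -/
theorem integral_norm_sq_add_gradient {w : UnitAddTorus d → EuclideanSpace ℝ d}
    {φ : UnitAddTorus d → ℝ} (hw : IsSmooth w) (hdiv : IsDivFree w) (hφ : IsSmooth φ) :
    ∫ x, ‖w x + Torus.gradient φ x‖ ^ 2 =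
      (∫ x, ‖w x‖ ^ 2) + ∫ x, ‖Torus.gradient φ x‖ ^ 2 := by
  have hg := hφ.gradient
  have hexp : ∀ x, ‖w x + Torus.gradient φ x‖ ^ 2 =
      ‖w x‖ ^ 2 + 2 * ⟪Torus.gradient φ x, w x⟫_ℝ + ‖Torus.gradient φ x‖ ^ 2 := fun x => by
    rw [norm_add_sq_real, real_inner_comm]
  simp_rw [hexp]
  rw [integral_add, integral_add, integral_const_mul,
    integral_inner_gradient_eq_zero_of_isDivFree hw hφ hdiv, mul_zero, add_zero]
  · exact hw.norm_sq.integrable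
  · exact ((hg.inner hw).integrable.const_mul 2)
  · exact hw.norm_sq.integrable.add ((hg.inner hw).integrable.const_mul 2)
  · exact hg.norm_sq.integrable

/-- **`L²`-contractivity of the solenoidal part** (Robinson–Rodrigo–Sadowski 2016, Thm. 2.6:
`‖h‖ ≤ ‖u‖` from `‖h‖² + ‖∇g‖² = ‖u‖²`; `ℙ` is an orthogonal projection): for smooth
divergence-free `w` and smooth `φ`, `‖w‖_{L²} ≤ ‖w + ∇φ‖_{L²}`. Applied to differences of two
decompositions it gives `‖w₁ - w₂‖_{L²} ≤ ‖G₁ - G₂‖_{L²}`. [cite: RobinsonRodrigoSadowskiCUP2016, Thm. 2.6 (pp. 43–44)] -/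
theorem eLpNorm_le_eLpNorm_add_gradient {w : UnitAddTorus d → EuclideanSpace ℝ d}
    {φ : UnitAddTorus d → ℝ} (hw : IsSmooth w) (hdiv : IsDivFree w) (hφ : IsSmooth φ) :
    eLpNorm w 2 volume ≤ eLpNorm (fun x => w x + Torus.gradient φ x) 2 volume := by
  have hs : IsSmooth fun x => w x + Torus.gradient φ x := hw.add hφ.gradient
  rw [(hw.memLp 2).eLpNorm_eq_integral_rpow_norm two_ne_zero ENNReal.ofNat_ne_top,
    (hs.memLp 2).eLpNorm_eq_integral_rpow_norm two_ne_zero ENNReal.ofNat_ne_top]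
  refine ENNReal.ofReal_le_ofReal (Real.rpow_le_rpow (integral_nonneg fun _ => by positivity) ?_
    (by norm_num))
  simp only [ENNReal.toReal_ofNat, Real.rpow_two]
  rw [integral_norm_sq_add_gradient hw hdiv hφ]
  have h0 : 0 ≤ ∫ x, ‖Torus.gradient φ x‖ ^ 2 := integral_nonneg fun x => sq_nonneg _
  linarith

/-- Contractivity for differences: two smooth Helmholtz decompositions `Gᵢ = wᵢ + ∇φᵢ`
(`div wᵢ = 0`) satisfy `‖w₁ - w₂‖_{L²} ≤ ‖G₁ - G₂‖_{L²}` (`ℙ` has operator norm `≤ 1`;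
Robinson–Rodrigo–Sadowski 2016, Thm. 2.6 / Def. 2.8). [cite: RobinsonRodrigoSadowskiCUP2016, Thm. 2.6 (pp. 43–44)] -/
theorem eLpNorm_sub_le_of_helmholtz {G₁ G₂ w₁ w₂ : UnitAddTorus d → EuclideanSpace ℝ d}
    {φ₁ φ₂ : UnitAddTorus d → ℝ} (hw₁ : IsSmooth w₁) (hw₂ : IsSmooth w₂) (hdiv₁ : IsDivFree w₁)
    (hdiv₂ : IsDivFree w₂) (hφ₁ : IsSmooth φ₁) (hφ₂ : IsSmooth φ₂)
    (h₁ : ∀ x, G₁ x = w₁ x + Torus.gradient φ₁ x) (h₂ : ∀ x, G₂ x = w₂ x + Torus.gradient φ₂ x) :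
    eLpNorm (w₁ - w₂) 2 volume ≤ eLpNorm (G₁ - G₂) 2 volume := by
  have h1 : IsContDiff 1 w₁ := hw₁.isContDiff (by simp)
  have h2 : IsContDiff 1 w₂ := hw₂.isContDiff (by simp)
  have hG : G₁ - G₂ = fun x => (w₁ - w₂) x + Torus.gradient (φ₁ - φ₂) x := by
    funext x
    rw [Pi.sub_apply, h₁ x, h₂ x, Pi.sub_apply,
      gradient_sub (hφ₁.isContDiff (by simp)) (hφ₂.isContDiff (by simp))]
    abel
  rw [hG]
  exact eLpNorm_le_eLpNorm_add_gradient (hw₁.sub hw₂) (isDivFree_sub h1 h2 hdiv₁ hdiv₂)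
    (hφ₁.sub hφ₂)

/-- **A divergence-free gradient vanishes** on the torus: if `φ` is smooth and `div ∇φ = 0`
(i.e. `φ` is harmonic) then `∇φ = 0` (`∫‖∇φ‖² = ∫⟪∇φ, ∇φ⟫ = 0` by integration by parts against
the divergence-free field `∇φ`; the integrand is continuous and nonnegative). [folklore] -/
theorem gradient_eq_zero_of_isDivFree {φ : UnitAddTorus d → ℝ} (hφ : IsSmooth φ)
    (hdiv : IsDivFree (Torus.gradient φ)) : Torus.gradient φ = 0 := by
  have hg := hφ.gradient
  have h0 : ∫ x, ‖Torus.gradient φ x‖ ^ 2 = 0 := by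
    simp_rw [← real_inner_self_eq_norm_sq]
    exact integral_inner_gradient_eq_zero_of_isDivFree hg hφ hdiv
  have hae : (fun x => ‖Torus.gradient φ x‖ ^ 2) =ᵐ[volume] 0 :=
    (integral_eq_zero_iff_of_nonneg (f := fun x => ‖Torus.gradient φ x‖ ^ 2)
      (fun x => sq_nonneg _) hg.norm_sq.integrable).1 h0
  have heq : (fun x => ‖Torus.gradient φ x‖ ^ 2) = 0 :=
    (Continuous.ae_eq_iff_eq volume (hg.continuous.norm.pow 2) continuous_const).1 hae
  funext x
  have hx := congrFun heq x
  simp only [Pi.zero_apply, ne_eq, OfNat.ofNat_ne_zero, not_false_eq_true, pow_eq_zero_iff,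
    norm_eq_zero] at hx
  exact hx

/-- **Uniqueness of the solenoidal part** (Robinson–Rodrigo–Sadowski 2016, Thm. 2.6,
uniqueness): if `w₁ + ∇φ₁ = w₂ + ∇φ₂` with `wᵢ` smooth and divergence free and `φᵢ` smooth, then
`w₁ = w₂` (and hence `∇φ₁ = ∇φ₂`). [cite: RobinsonRodrigoSadowskiCUP2016, Thm. 2.6 uniqueness (p. 44)] -/
theorem helmholtz_unique {w₁ w₂ : UnitAddTorus d → EuclideanSpace ℝ d} {φ₁ φ₂ : UnitAddTorus d → ℝ}
    (hw₁ : IsSmooth w₁) (hw₂ : IsSmooth w₂) (hdiv₁ : IsDivFree w₁) (hdiv₂ : IsDivFree w₂)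
    (hφ₁ : IsSmooth φ₁) (hφ₂ : IsSmooth φ₂)
    (h : ∀ x, w₁ x + Torus.gradient φ₁ x = w₂ x + Torus.gradient φ₂ x) : w₁ = w₂ := by
  have h1 : IsContDiff 1 w₁ := hw₁.isContDiff (by simp)
  have h2 : IsContDiff 1 w₂ := hw₂.isContDiff (by simp)
  -- `w₁ - w₂ = ∇(φ₂ - φ₁)` is a divergence-free gradient, hence zero
  have hgrad : Torus.gradient (φ₂ - φ₁) = w₁ - w₂ := by
    funext x
    rw [gradient_sub (hφ₂.isContDiff (by simp)) (hφ₁.isContDiff (by simp)), Pi.sub_apply]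
    have hx := h x
    -- from `w₁ + ∇φ₁ = w₂ + ∇φ₂` deduce `∇φ₂ - ∇φ₁ = w₁ - w₂`
    rw [sub_eq_sub_iff_add_eq_add, add_comm, ← hx, add_comm]
  have hz : Torus.gradient (φ₂ - φ₁) = 0 :=
    gradient_eq_zero_of_isDivFree (hφ₂.sub hφ₁) (hgrad ▸ isDivFree_sub h1 h2 hdiv₁ hdiv₂)
  rw [hgrad] at hz
  exact sub_eq_zero.1 hz

/-- **Periodicity of the solenoidal part.** If `G` is `τ`-periodic in time and
`G(t) = w(t) + ∇φ(t)` for all `t` with `w(t)` smooth divergence free and `φ(t)` smooth, then `w`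
is `τ`-periodic (uniqueness of the solenoidal part at the times `t` and `t + τ`). [folklore] -/
theorem periodic_of_helmholtz {G w : ℝ → UnitAddTorus d → EuclideanSpace ℝ d}
    {φ : ℝ → UnitAddTorus d → ℝ} {τ : ℝ} (hG : Periodic G τ) (hw : ∀ t, IsSmooth (w t))
    (hdiv : ∀ t, IsDivFree (w t)) (hφ : ∀ t, IsSmooth (φ t))
    (h : ∀ t x, G t x = w t x + Torus.gradient (φ t) x) : Periodic w τ := fun t =>
  helmholtz_unique (hw (t + τ)) (hw t) (hdiv (t + τ)) (hdiv t) (hφ (t + τ)) (hφ t) fun x => by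
    rw [← h (t + τ) x, ← h t x, hG t]

end Literature.Analysis.FunctionSpaces.Torus


end
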